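import Literature.AlgebraicGeometry.Resolution.PointBlowupShade

/-!
# [OURS · L1 W4.6] Rung (iii) "Moh window" for the classical pair, SURFACES — the TERMINATION statement
  (statement-only file: two OURS predicates, no theorems)

Cell `res-hironaka`, LADDER-RESOLUTION rung L (D-0089), slot W4.6 (restricted regimes as rungs of the typed
Th. 16.6 procedure), rung (iii) «purely inseparable `z^p = f` with `ord f < 2p` (Moh window)»; seat
`res-L1-s46-pv-6` (gen 3).  Host route MarkedTransfer, `--kind definition --supports
stmt-ResolutionOfSingularities-16155 --as helper`.  Siblings (NOT imported, NOT modified): the seat's statement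
files `…MohWindowShadeStatement.lean` (desk #35: NoKangaroo / Frozen / CentreNoKangaroo / Antitone — the
NO-INCREASE half) and `…MohWindowShadeExitStatement.lean` (desk #73: exit / terminal / decrease / cycle
predicates), res-L1-type-o1's `…TerminatesFin.lean` (desk #99).  THIS FILE types the missing TERMINATION half
for SURFACES, whose necessity and shape the seat's negative files fixed: for ARBITRARY point centres there are
in-window two-cycles in every characteristic and a fixed point (`…Cycle.exists_infinite_walk_in_window`,
`…FixedPoint.exists_infinite_walk_in_window`) and hence no strictly decreasing invariant (`…NoInvariant`);
all of them sit on a `p`-fold CURVE (`F = y·h^p`).  The statement below says that this is the only way an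
in-window walk of `p`-fold points of the surface `x^p + F(y_j, y_i)` can be infinite.

Vocabulary (tree, `Literature/AlgebraicGeometry/Resolution/PointBlowupShade.lean`, the typed model of
[Hauser2010, §§F–G]): a state `s : PointBlowup.State σ K` of `x^p + F(y)` (`F` the residual polynomial, kept
cleaned of `p`-th power monomials; `y^r` the exceptional monomial), `PointBlowup.step p c b s` the blow-up of
the origin read in the chart `y_c` at the point `b` of the new exceptional divisor (`b c = 0`) followed by the
cleaning, `PointBlowup.IsEquimultiplePoint`, `Hauser2010.deletePthPowers`, `Hauser2010.ordZero`.
PRESENTATION OF WALKS (the Hauser–Wagner frame, [HauserWagner2014, §5 p. 197 l. 20–30], = the tree's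
`HauserWagner2014.moveT / moveV` of `PointBlowupHeight.lean`): with two residual letters `σ = {j, i}`, every
closed point of the exceptional curve of a point blow-up is either the point `t` of the `y_i`-axis in the
chart `y_j` (`t = 0`: horizontal move, `t ≠ 0`: translational move) or the origin of the chart `y_i`
(vertical move); a walk below is a sequence of such moves: chart `c n ∈ {j, i}`, and `b n = 0` when `c n = i`.

* `CampaignW46MohWindowShadeFormalCurveCase p m F` — the FORMAL `p`-FOLD-CURVE CASE to order `m`:
  `F ≡ h^p · w` modulo monomials of degree `≥ m`, for polynomials `h, w` with `h(0) = 0` and some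
  `∂h/∂y_l(0) ≠ 0` (a smooth curve germ `h = 0`).  For all `m` at once this says that `F` is, formally, the
  `p`-th power of a smooth curve times a cofactor — then `x^p + F` has the curve `{x = ·, h = 0}` of `p`-fold
  points (on the nose for `F = y·h^p`, the seat's cycles and fixed point); a state with a monomial
  `y_j^a y_i^b`, `a, b < p`, of degree `< m` is never in it (companion proof file, `…TerminationHolds`).
* `CampaignW46MohWindowShadeSurfaceTerminates p K σ` — THE RUNG, termination half, surfaces: along every
  INFINITE walk of point blow-ups of `x^p + F(y_j, y_i)` presented in the Hauser–Wagner frame, from a cleaned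
  state with `y^r ∣ F`, every step equimultiple and every state inside the window `p ≤ ord F_n < 2p` (design
  point (REG): the regime is imposed at every stage), SOME state is in the formal `p`-fold-curve case to every
  order.  Contrapositive: a walk of `p`-fold points that stays in the window and off the formal `p`-fold-curve
  case (e.g. isolated `p`-fold points at every stage) is FINITE.

VACUITY / STRENGTH SELF-CHECK (typer): NOT trivially true — the antecedent of `…SurfaceTerminates` is
INHABITED by infinite walks: the seat's `MohWindowShadeCycle.exists_infinite_walk_in_window` (every `p`) and
`MohWindowShadeFixedPoint.exists_infinite_walk_in_window` (`p = 2`) are walks in the chart `y_1` at translated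
points, i.e. in the frame with `j = 1`, `i = 0`, cleaned, `y^r ∣ F`, equimultiple, of order `p + 1 < 2p`
(kernel companion: `…TerminationHolds.antecedent_inhabited`); and the conclusion is NOT automatic — e.g. the
terminal state `(y_j^2 y_i^2, (2,2))`, `p = 3`, satisfies every state hypothesis and is not in the formal curve
case to order `5` (`…TerminationHolds.not_formalCurveCase_of_small_monomial`).  NOT trivially false — closed by
name in `…TerminationHolds.lean` (`campaignW46MohWindowShadeSurfaceTerminates_holds`, every prime `p`, every
field of characteristic `p`, every two-letter `σ`) from the seat's gen-3 proof files `…Cleaning`, `…RunFormula`,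
`…Adapted`, `…StallWalk`, `…Termination`.  What is NOT claimed: a bound on the length of finite walks uniform
in the initial state (none exists in terms of `(o, r)` alone: the horizontal runs have length the Newton
ratio of the residual factor, gen 2 HANDOFF); dimension `≥ 3` (`|σ| ≥ 3`); walks presented outside the
Hauser–Wagner frame (translated points read in the chart `y_i`) — the same geometric points, another
coordinate presentation, not covered by this decl.  Candidates not facts; nothing of H. Hironaka's manuscript
[claim: Hironaka2017, status: under-review] is used or asserted; the role named is the one the predicate
REPLACES in regime (iii), it is NOT a statement of the manuscript.  AI-written; AI review is weaker than
expert review.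
-/

noncomputable section

set_option linter.dupNamespace false -- mandated namespace of this single-conjunct summit

namespace Summit.ResolutionOfSingularities.ResolutionOfSingularities.Theorems

open Literature.AlgebraicGeometry.Resolution
open Literature.AlgebraicGeometry.Resolution.Hauser2010

/-- [OURS · L1 W4.6] replaces the role of the «`p`-fold curve» alternative of the centre rule of Th. 16.6 /
Th. 16.13 (ms. p. 84 l. 10–20, p. 87 l. 25–29) in regime (iii) for the classical pair, surfaces — the FORMAL
`p`-FOLD-CURVE CASE to order `m` of a residual polynomial `F` of `x^p + F(y)`: there are polynomials `h, w`
with `h(0) = 0`, some linear coefficient `∂h/∂y_l(0) ≠ 0` (so `h = 0` is a smooth curve germ), and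
`ord₀(F − h^p·w) ≥ m`.  For every `m` at once: `F` is formally the `p`-th power of a smooth curve times a
cofactor (e.g. `F = y·h^p`, the seat's in-window cycles and fixed point).  NOT a statement of the manuscript. -/
def CampaignW46MohWindowShadeFormalCurveCase (p m : ℕ) {σ : Type*} {K : Type*} [CommRing K]
    (F : MvPolynomial σ K) : Prop :=
  ∃ h w : MvPolynomial σ K, MvPolynomial.coeff 0 h = 0 ∧
    (∃ l, MvPolynomial.coeff (Finsupp.single l 1) h ≠ 0) ∧ (m : ℕ∞) ≤ ordZero (F - h ^ p * w)

/-- [OURS · L1 W4.6] replaces the role of the termination clause of Th. 16.13, ms. p. 87 l. 25–29 (with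
Th. 16.6 (2) / Eq. (127), p. 84 l. 10–20), in regime (iii) «purely inseparable, `p ≤ ord F < 2p` at every
stage» for the classical pair (order, shade), SURFACES (two residual letters `σ = {j, i}`), walks presented in
the Hauser–Wagner frame: for every sequence of states `s_{n+1} = PointBlowup.step p (c n) (b n) (s n)` — chart
`c n`, point `b n` of the new exceptional divisor (`b n (c n) = 0`), translated points read in the chart `y_j`
only (`b n = 0` whenever `c n = i`) — starting from a cleaned state with `y^r ∣ F`, with every step
EQUIMULTIPLE and every state inside the window (`p ≤ ord₀ F_n < 2p`), there is a stage `n` at which the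
residual polynomial is in the formal `p`-fold-curve case to EVERY order
(`CampaignW46MohWindowShadeFormalCurveCase p m (s n).F` for all `m`).  Equivalently: no infinite in-window walk
of `p`-fold points of the surface `x^p + F(y_j, y_i)` avoids the formal `p`-fold-curve case.  NOT a statement
of the manuscript. -/
def CampaignW46MohWindowShadeSurfaceTerminates (p : ℕ) (K : Type*) [Field K] [DecidableEq K] [CharP K p]
    (σ : Type*) [Fintype σ] [DecidableEq σ] : Prop :=
  ∀ (j i : σ), i ≠ j → (∀ l, l = j ∨ l = i) →
    ∀ (s : ℕ → PointBlowup.State σ K) (c : ℕ → σ) (b : ℕ → σ → K),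
      (∀ n, b n (c n) = 0) → (∀ n, c n = i → ∀ l, b n l = 0) →
      (∀ n, s (n + 1) = PointBlowup.step p (c n) (b n) (s n)) →
      deletePthPowers p (s 0).F = (s 0).F → (∀ d ∈ (s 0).F.support, (s 0).r ≤ d) →
      (∀ n, PointBlowup.IsEquimultiplePoint p (c n) (b n) (s n)) →
      (∀ n, (p : ℕ∞) ≤ ordZero (s n).F ∧ ordZero (s n).F < (2 * p : ℕ)) →
      ∃ n, ∀ m : ℕ, CampaignW46MohWindowShadeFormalCurveCase p m (s n).F

/-! ## v2 (gen 3, APPEND-ONLY): the FINAL FORM — a formal curve of `p`-fold points in `K[[y_j, y_i]]` -/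

/-- [OURS · L1 W4.6] replaces the role of the termination clause of Th. 16.13, ms. p. 87 l. 25–29 (with Th. 16.6 (2) /
Eq. (127), p. 84 l. 10–20), in regime (iii) «purely inseparable, `p ≤ ord F < 2p` at every stage» for the classical
pair, SURFACES, walks presented in the Hauser–Wagner frame — FINAL FORM, ON THE NOSE IN THE FORMAL POWER SERIES RING:
hypotheses exactly as in `CampaignW46MohWindowShadeSurfaceTerminates` (infinite walk `s_{n+1} = PointBlowup.step p (c n)
(b n) (s n)`, `b n (c n) = 0`, `b n = 0` when `c n = i`, cleaned start with `y^r ∣ F`, every step equimultiple, every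
state inside the window); conclusion: at some stage `n` there are formal power series `h, W ∈ K[[y]]` with `h(0) = 0`,
some linear coefficient of `h` non-zero (a SMOOTH formal curve germ), and `(F_n : K[[y]]) = h^p · W` — the residual
polynomial is divisible in `K[[y_j, y_i]]` by the `p`-th power of a smooth formal curve, i.e. `x^p + F_n` carries a
formal curve of `p`-fold points through the point (`h` is a letter `y_l`, or the branch `y_i − Σ_k t_{n+k} y_j^{k+1}`
whose digits `t` are the later points of the walk).  Implies the v1 predicate (truncate).  Closed by name in
`…MohWindowShadeTerminationFormalHolds.lean` from `…MohWindowShadeFormalBranch.exists_formal_pfold_curve_of_walk`.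
NOT a statement of the manuscript. -/
def CampaignW46MohWindowShadeSurfaceMeetsFormalCurve (p : ℕ) (K : Type*) [Field K] [DecidableEq K] [CharP K p]
    (σ : Type*) [Fintype σ] [DecidableEq σ] : Prop :=
  ∀ (j i : σ), i ≠ j → (∀ l, l = j ∨ l = i) →
    ∀ (s : ℕ → PointBlowup.State σ K) (c : ℕ → σ) (b : ℕ → σ → K),
      (∀ n, b n (c n) = 0) → (∀ n, c n = i → ∀ l, b n l = 0) →
      (∀ n, s (n + 1) = PointBlowup.step p (c n) (b n) (s n)) →
      deletePthPowers p (s 0).F = (s 0).F → (∀ d ∈ (s 0).F.support, (s 0).r ≤ d) →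
      (∀ n, PointBlowup.IsEquimultiplePoint p (c n) (b n) (s n)) →
      (∀ n, (p : ℕ∞) ≤ ordZero (s n).F ∧ ordZero (s n).F < (2 * p : ℕ)) →
      ∃ (n : ℕ) (h W : MvPowerSeries σ K), MvPowerSeries.constantCoeff h = 0 ∧
        (∃ l, MvPowerSeries.coeff (Finsupp.single l 1) h ≠ 0) ∧ ((s n).F : MvPowerSeries σ K) = h ^ p * W

end Summit.ResolutionOfSingularities.ResolutionOfSingularities.Theorems

end
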